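import Literature.NumberTheory.EllipticCurves.CanonicalPAdicHeightOfSigmaExistenceProofs
import Literature.NumberTheory.EllipticCurves.PadicSigmaExistenceProofs
import HarnessLib

/-!
# The canonical `p`-adic height exists (over `ℚ` and over number fields) — discharged

Trunk T-NT-EC (Literature/NumberTheory/EllipticCurves); proof file (no definitions, no named
facts) for the two existence facts of `CanonicalPAdicHeight.lean`:

* `WeierstrassCurve.exists_isCanonical` — for `E/ℚ` with globally minimal `W` and a prime `p ≥ 5`
  of good ordinary reduction there is a canonical `p`-adic height datum (Schneider 1982 /
  Mazur–Tate 1983; sigma formula Mazur–Stein–Tate 2006 §1, Stein–Wuthrich 2013 §4.1 (4.1));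
* `WeierstrassCurve.exists_isCanonicalK` — the same over a number field `K` in which `p` is
  totally split, `W ⊗ K` globally minimal (Balakrishnan–Çiperiani–Stein 2015, §4.1 eq. (4.1);
  Perrin-Riou 1987, §1.2; Mazur–Tate–Teitelbaum 1986, §II.4–5).

`CanonicalPAdicHeightOfSigmaExistenceProofs.lean` reduced both to the single named fact
`WeierstrassCurve.mazur_tate_sigma_existsUnique` (Mazur–Stein–Tate 2006, Thm. 1.3 = Mazur–Tate
1991, Thm. 3.1: existence and uniqueness of the canonical `p`-adic sigma function), by
`exists_isCanonical_of_mazur_tate_sigma_existsUnique` and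
`exists_isCanonicalK_of_mazur_tate_sigma_existsUnique`; that fact has since been discharged
(`WeierstrassCurve.mazur_tate_sigma_existsUnique_holds`, `PadicSigmaExistenceProofs.lean`, via
Blakestad–Grant 2023, Thm. 1), so both existence statements hold outright, together with the
uniqueness of the `ℚ`-datum. This file only composes (librarian sweep `libsplit-39`, fact
decomposition 2026-08-16: the fact was found provable as filed, hence discharged rather than
split).

## Sources

* B. Mazur, W. Stein, J. Tate, *Computation of `p`-adic heights and log convergence*, Doc. Math.
  Extra Vol. Coates (2006), Thm. 1.3, §1, §2.6–2.7. [MazurSteinTate2006]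
* W. Stein, C. Wuthrich, Math. Comp. 82 (2013), §4.1 eq. (4.1). [SteinWuthrich2013]
* J. S. Balakrishnan, M. Çiperiani, W. Stein, *p-adic heights of Heegner points and Λ-adic
  regulators*, Math. Comp. 84 (2015), §4.1 eq. (4.1). [BalakrishnanCiperianiStein2015]
-/

noncomputable section

namespace WeierstrassCurve

/-- **Existence of the canonical `p`-adic height over `ℚ`, discharged**: the named fact
`WeierstrassCurve.exists_isCanonical` holds (for `W/ℚ` globally minimal elliptic and `p ≥ 5` good
ordinary there is a canonical datum `D : PAdicHeightData W p`), by
`exists_isCanonical_of_mazur_tate_sigma_existsUnique mazur_tate_sigma_existsUnique_holds`.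
[cite: MazurSteinTate2006, Thm. 1.3 and §1] -/
theorem exists_isCanonical_holds : exists_isCanonical :=
  exists_isCanonical_of_mazur_tate_sigma_existsUnique mazur_tate_sigma_existsUnique_holds

/-- **Uniqueness of the canonical `p`-adic height datum over `ℚ`** (admissible multiples exist),
now unconditional. [cite: MazurSteinTate2006, §1] -/
theorem existsUnique_isCanonical_holds (W : WeierstrassCurve ℚ) [W.IsElliptic]
    [W.IsGloballyMinimal] (p : ℕ) [Fact p.Prime] (hp : 5 ≤ p)
    (hgood : W.HasGoodReductionAtPrime p) (hord : ¬ (p : ℤ) ∣ W.frobeniusTrace p) :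
    ∃! D : PAdicHeightData W p, D.IsCanonical :=
  existsUnique_isCanonical_of_mazur_tate_sigma_existsUnique mazur_tate_sigma_existsUnique_holds W p
    hp hgood hord

/-- **Existence of the canonical `p`-adic height over a number field `K` (`p ≥ 5` totally split
in `K`, good ordinary, `W ⊗ K` globally minimal), discharged**: the named fact
`WeierstrassCurve.exists_isCanonicalK` holds, by
`exists_isCanonicalK_of_mazur_tate_sigma_existsUnique mazur_tate_sigma_existsUnique_holds`.
[cite: BalakrishnanCiperianiStein2015, §4.1 eq. (4.1)] -/
theorem exists_isCanonicalK_holds : exists_isCanonicalK :=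
  exists_isCanonicalK_of_mazur_tate_sigma_existsUnique mazur_tate_sigma_existsUnique_holds

end WeierstrassCurve

end
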